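import Literature.AnabelianGeometry.EtaleTheta.SettingModel2
import Literature.AnabelianGeometry.EtaleTheta.SettingModelInversion
import HarnessLib

/-!
# The FINER model of the [EtTh] §1 root, inversion profile: the pointed inversion `ι` at `ThetaSetting.model₂ p`

S. Mochizuki, *The étale theta function and its Frobenioid-theoretic manifestations*, Publ. RIMS **45** (2009) [EtTh]:
§1 p. 12 (PRIMS p. 238) «`Δ_X` … a profinite free group on 2 generators», «a natural surjection `Π^tp_X ↠ Z`», «a natural
exact sequence of abelian profinite groups `1 → Δ_Θ → (Δ^tp_Y)^Θ → (Δ^tp_Y)^ell → 1`»; §2 p. 36 (PRIMS p. 262) «`ι` …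
“multiplication by `−1`”»; Prop. 2.2 (i) p. 37. [IUTchII] Rmk. 1.4.1 (ii) p. 28, Prop. 2.2 (ii) pp. 65–67.
[cite: MochizukiEtTh2009, §2 p.36]

Cell abc-iut, seat abc-iut-w5-d072 (gen 3; (R1) ι-datum custody, GAP G-w4d010-2 / D-G-w4d010-2h). abc-iut-L2-t1's FINER
root model `ThetaSetting.model₂ p` (`SettingModel2*.lean`: `Π^tp_X := (F̂₂ ×_Ẑ ℤ) × G_{ℚ_p}` with abc-iut-w5-d218's tempered
fibre product `Γ = F̂₂ ×_Ẑ ℤ` as geometric factor; `Π_X = F̂₂ × Ĝ_{ℚ_p}` as for the discrete model; `Z`-quotient `pr₂`) is the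
model in which the closedness binder `hYcl` of GAP G-w4d021-2 HOLDS (`hYcl_model₂`), unlike the discrete model
(`SettingModelIndependence.hYcl_not_derivable`). This file equips it with its pointed inversion, upgrading the inversion
profile of `SettingModelInversion.lean` (p424489, discrete model) to the finer model:

* §1 **`sigmaHat : F̂₂ →ₜ* F̂₂`, the completed inversion** — the continuous extension of `η ∘ σ` (`σ = invGenHom`: `a ↦ a⁻¹`,
  `b ↦ b⁻¹`) along `η : F₂ → F̂₂` (Mathlib's universal property of the profinite completion): `sigmaHat_eta`
  (`σ̂ ∘ η = η ∘ σ`), `sigmaHat_sigmaHat` (involution) and **`eHat_sigmaHat : ê ∘ σ̂ = ê⁻¹`** (`ê` = the completed `a`-exponent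
  sum), the last two by density of `η(F₂)`; `sigmaHatEquiv : F̂₂ ≃ₜ* F̂₂`.
* §2 **`gfpInv : Γ ≃ₜ* Γ`, `(x, n) ↦ (σ̂ x, n⁻¹)`** — the inversion of the tempered fibre product (well defined by `ê ∘ σ̂ = ê⁻¹`),
  and **`SettingModel.inversion₂ p : (ThetaSetting.model₂ p).PiTemp ≃ₜ* _`** `:= gfpInv × id`: an involution
  (`inversion₂_inversion₂`), `≠ 1` (`inversion₂_ne_refl`), over `G_{ℚ_p}` (`aug_inversion₂`), (R1b′) `map_deltaTemp_inversion₂`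
  (BY NAME from abc-iut-w4-d014's `map_deltaTemp_eq_of_aug_comp`), **(R1c) `toZ_inversion₂ : toZ (ι g) = (toZ g)⁻¹`** (`rfl`:
  `toZ = pr₂`).
* §3 **(R1e′) holds**: `inversion₂_hinv`. Route: the two models SHARE `Π_X = F̂₂ × Ĝ_{ℚ_p}` and `Δ_X = F̂₂ × 1`
  (`deltaHat_eq`, `deltaHat₂_eq`), and the extended automorphisms coincide — `completionAut_inversion₂_eq :
  ι̂₂ = ι̂₁` (uniqueness of extensions along the DISCRETE model's `Π^tp_X ↪ Π_X`, on whose image both equal `(η ∘ σ) × η_Γ`) —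
  so p424489's `inversion_hinv` transfers verbatim.
* §4 headline **`ThetaSetting.exists_isEtThOrigin_hYcl_inversion`**: the inversion datum {`ι` involutive, `≠ 1`, over `G_K`, hΔ,
  `IsQuotientMap toTheta`, `Z`-reversal, (R1e′)} is jointly satisfiable with the origin guard `IsEtThOrigin` AND the closedness
  clause `hYcl` — strictly more than `ThetaSetting.exists_isEtThOrigin_inversion` (p424489), whose witness refutes `hYcl`.

HONEST LIMITS: consistency evidence at the ROOT level (no `KummerData`/`DoubleUnderline` over this model either: the arithmetic
factor is split, no cyclotomic action — abc-iut-L2-lead R77); the mechanism is the genuine one (`−1` on `F̂₂^ab`, `−1` on `Z`).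
Definitions added: `sigmaHat`, `sigmaHatEquiv`, `gfpInv`, `inversionM₂`, `inversion₂`, `genA₂` (no instances, no Prop facts).
[EtTh] is refereed; nothing here bears on [IUTchIII] Cor. 3.12; typed ≠ proved; instantiated ≠ endorsed.
-/

noncomputable section

namespace Literature.AnabelianGeometry.EtaleTheta.SettingModel

open Literature.AnabelianGeometry.SemiGraphs
open CategoryTheory Function
open scoped commutatorElement
open _root_.Topology

/-! ## §1. The completed inversion `σ̂ : F̂₂ → F̂₂` -/

/-- **`σ̂ : F̂₂ → F̂₂`**, the continuous extension of `η ∘ σ` (`σ : a ↦ a⁻¹, b ↦ b⁻¹`) along `η : F₂ → F̂₂` — the action of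
the inversion on `Δ_X` («multiplication by `−1`», [EtTh] p. 36). [cite: MochizukiEtTh2009, §2 p.36] -/
def sigmaHat : F₂hatT →ₜ* F₂hatT :=
  (ProfiniteGrp.ProfiniteCompletion.lift (P := F₂hat) (GrpCat.ofHom (eta.comp invGenHom))).hom

/-- `σ̂ (η g) = η (σ g)`. [cite: MochizukiEtTh2009, §2 p.36] -/
theorem sigmaHat_eta (g : F₂) : sigmaHat (eta g) = eta (invGenHom g) :=
  lift_hom_toCompletion F₂hat (eta.comp invGenHom) g

/-- **`σ̂` is an involution** (`σ̂ ∘ σ̂ = id`: both sides continuous, equal on the dense `η(F₂)`).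
[cite: MochizukiEtTh2009, §2 p.36] -/
theorem sigmaHat_comp_sigmaHat : (sigmaHat ∘ sigmaHat : F₂hatT → F₂hatT) = id :=
  Continuous.ext_on denseRange_eta (sigmaHat.continuous.comp sigmaHat.continuous) continuous_id
    (by
      rintro _ ⟨g, rfl⟩
      simp only [comp_apply, id_eq]
      rw [sigmaHat_eta, sigmaHat_eta, invGenHom_invGenHom])

/-- `σ̂ (σ̂ x) = x`. [cite: MochizukiEtTh2009, §2 p.36] -/
@[simp] theorem sigmaHat_sigmaHat (x : F₂hatT) : sigmaHat (sigmaHat x) = x :=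
  congrFun sigmaHat_comp_sigmaHat x

/-- **`ê ∘ σ̂ = ê⁻¹`**: the completed inversion NEGATES the completed `a`-exponent sum `ê : F̂₂ → Ẑ` (on `η(F₂)`:
`ê(η(σ g)) = ι(expA (σ g)) = ι(expA g)⁻¹`; both sides continuous). [cite: MochizukiEtTh2009, §1 p.12] -/
theorem eHat_sigmaHat (x : F₂hatT) : eHat (sigmaHat x) = (eHat x)⁻¹ := by
  have h : (eHat ∘ sigmaHat : F₂hatT → ZH) = fun x => (eHat x)⁻¹ :=
    Continuous.ext_on denseRange_eta (eHat.continuous.comp sigmaHat.continuous) eHat.continuous.inv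
      (by
        rintro _ ⟨g, rfl⟩
        simp only [comp_apply]
        rw [sigmaHat_eta, eHat_eta, eHat_eta, hom_invGenHom expA g, map_inv])
  exact congrFun h x

/-- `σ̂` as a topological automorphism of `F̂₂`. [cite: MochizukiEtTh2009, §2 p.36] -/
def sigmaHatEquiv : F₂hatT ≃ₜ* F₂hatT where
  toFun := sigmaHat
  invFun := sigmaHat
  left_inv := sigmaHat_sigmaHat
  right_inv := sigmaHat_sigmaHat
  map_mul' := map_mul sigmaHat
  continuous_toFun := sigmaHat.continuous
  continuous_invFun := sigmaHat.continuous

/-! ## §2. The inversion of the fibre product `Γ = F̂₂ ×_Ẑ ℤ` and of `Π^tp_X = Γ × G_{ℚ_p}` -/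

/-- The inversion `(x, n) ↦ (σ̂ x, n⁻¹)` preserves the fibre product (`ê(σ̂ x) = ê(x)⁻¹ = ι(n)⁻¹ = ι(n⁻¹)`).
[cite: MochizukiEtTh2009, §1 p.12] -/
theorem inv_mem_Gfp (γ : Gfp) :
    ((sigmaHat (γ : F₂hatT × Multiplicative ℤ).1, (γ : F₂hatT × Multiplicative ℤ).2⁻¹) :
      F₂hatT × Multiplicative ℤ) ∈ Gfp := by
  rw [mem_Gfp]
  change eHat (sigmaHat (γ : F₂hatT × Multiplicative ℤ).1) = iotaZ ((γ : F₂hatT × Multiplicative ℤ).2⁻¹)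
  rw [eHat_sigmaHat, (mem_Gfp _).mp γ.2, map_inv]

/-- The underlying function of the inversion of `Γ`. [cite: MochizukiEtTh2009, §1 p.12] -/
def gfpInvFun (γ : Gfp) : Gfp :=
  ⟨(sigmaHat (γ : F₂hatT × Multiplicative ℤ).1, (γ : F₂hatT × Multiplicative ℤ).2⁻¹), inv_mem_Gfp γ⟩

/-- [cite: MochizukiEtTh2009, §1 p.12] -/
theorem coe_gfpInvFun (γ : Gfp) :
    (gfpInvFun γ : F₂hatT × Multiplicative ℤ) =
      (sigmaHat (γ : F₂hatT × Multiplicative ℤ).1, (γ : F₂hatT × Multiplicative ℤ).2⁻¹) := rfl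

/-- [cite: MochizukiEtTh2009, §1 p.12] -/
theorem gfpInvFun_gfpInvFun (γ : Gfp) : gfpInvFun (gfpInvFun γ) = γ :=
  Subtype.ext (Prod.ext (sigmaHat_sigmaHat _) (inv_inv _))

/-- [cite: MochizukiEtTh2009, §1 p.12] -/
theorem continuous_gfpInvFun : Continuous gfpInvFun := by
  apply Continuous.subtype_mk
  exact (sigmaHat.continuous.comp (continuous_fst.comp continuous_subtype_val)).prodMk
    (continuous_of_discreteTopology.comp (continuous_snd.comp continuous_subtype_val))

/-- **The inversion of the tempered fibre product** `Γ = F̂₂ ×_Ẑ ℤ`: `(x, n) ↦ (σ̂ x, n⁻¹)` — `σ̂` on the profinite factor,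
`−1` on `Z` ([IUTchII] Rmk. 2.1.1 (i): the inversion reverses the `ℤ`-torsor of components). [cite: Mochizuki2012, Rmk 1.4.1 (ii) p.28] -/
def gfpInv : Gfp ≃ₜ* Gfp where
  toFun := gfpInvFun
  invFun := gfpInvFun
  left_inv := gfpInvFun_gfpInvFun
  right_inv := gfpInvFun_gfpInvFun
  map_mul' _ _ := Subtype.ext (Prod.ext (map_mul sigmaHat _ _) (mul_inv _ _))
  continuous_toFun := continuous_gfpInvFun
  continuous_invFun := continuous_gfpInvFun

/-- [cite: MochizukiEtTh2009, §1 p.12] -/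
@[simp] theorem coe_gfpInv (γ : Gfp) :
    (gfpInv γ : F₂hatT × Multiplicative ℤ) =
      (sigmaHat (γ : F₂hatT × Multiplicative ℤ).1, (γ : F₂hatT × Multiplicative ℤ).2⁻¹) := rfl

variable (p : ℕ) [Fact p.Prime]

/-- `ι := gfpInv × id` on `Π^tp_X = Γ × G_{ℚ_p}` (continuous: `Γ`-factor by §2, `G_{ℚ_p}`-factor the identity).
[cite: MochizukiEtTh2009, §2 p.36] -/
def inversionM₂ : PiTp₂ p ≃ₜ* PiTp₂ p where
  toMulEquiv := gfpInv.toMulEquiv.prodCongr (MulEquiv.refl (Gam p))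
  continuous_toFun := gfpInv.continuous.prodMap continuous_id
  continuous_invFun := gfpInv.symm.continuous.prodMap continuous_id

/-- **The pointed inversion of the finer root model** `ThetaSetting.model₂ p`. DEFINED. [cite: Mochizuki2012, Rmk 1.4.1 (ii) p.28] -/
def inversion₂ : (ThetaSetting.model₂ p).PiTemp ≃ₜ* (ThetaSetting.model₂ p).PiTemp := inversionM₂ p

/-- `ι (γ, τ) = (gfpInv γ, τ)`. [cite: MochizukiEtTh2009, §2 p.36] -/
@[simp] theorem inversion₂_apply (g : PiTp₂ p) : inversion₂ p g = (gfpInv g.1, g.2) := rfl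

/-- **`ι` is an involution.** [cite: MochizukiEtTh2009, §2 p.36] -/
@[simp] theorem inversion₂_inversion₂ (g : PiTp₂ p) : inversion₂ p (inversion₂ p g) = g :=
  Prod.ext (gfpInvFun_gfpInvFun g.1) rfl

/-- **`ι` is over `G_{ℚ_p}`.** [cite: Mochizuki2012, Rmk 1.4.1 (ii) p.28] -/
theorem aug_inversion₂ (g : PiTp₂ p) : (ThetaSetting.model₂ p).aug (inversion₂ p g) = (ThetaSetting.model₂ p).aug g := rfl

/-- **(R1b′)-hΔ at the finer model**: `ι(Δ^tp_X) = Δ^tp_X`, BY NAME from abc-iut-w4-d014's `map_deltaTemp_eq_of_aug_comp`.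
[cite: Mochizuki2012, Rmk 1.4.1 (ii) p.28] -/
theorem map_deltaTemp_inversion₂ :
    (ThetaSetting.model₂ p).DeltaTemp.map (inversion₂ p).toMulEquiv.toMonoidHom = (ThetaSetting.model₂ p).DeltaTemp :=
  (ThetaSetting.model₂ p).toTemperedCurve.map_deltaTemp_eq_of_aug_comp (inversion₂ p) (aug_inversion₂ p)

/-- **(R1c) at the finer model, on the nose**: `toZ (ι g) = (toZ g)⁻¹` for every `g` (`toZ = pr₂`, negated by `ι`).
[cite: Mochizuki2012, Prop 2.2 (ii) p.66] -/
theorem toZ_inversion₂ (g : PiTp₂ p) :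
    (ThetaSetting.model₂ p).toZ (inversion₂ p g) = ((ThetaSetting.model₂ p).toZ g)⁻¹ := rfl

/-- The graph element `(η a, expA a) ∈ Γ` of the generator `a`, in `Π^tp_X`. [cite: MochizukiEtTh2009, §1 p.12] -/
def genA₂ : PiTp₂ p := (⟨(eta (FreeGroup.of 0), expA (FreeGroup.of 0)), eta_mk_mem_Gfp _⟩, 1)

/-- `toZ (a) = 1 ∈ ℤ`. [cite: MochizukiEtTh2009, §1 p.12] -/
theorem toZ_genA₂ : (ThetaSetting.model₂ p).toZ (genA₂ p) = Multiplicative.ofAdd 1 := by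
  change expA (FreeGroup.of 0) = _
  rw [expA_apply, heisHom_of_zero]

/-- `a ∈ Δ^tp_X`. [cite: MochizukiEtTh2009, §1 p.12] -/
theorem genA₂_mem_deltaTemp : genA₂ p ∈ (ThetaSetting.model₂ p).DeltaTemp := (mem_deltaTemp₂_iff p _).mpr rfl

/-- **`ι ≠ 1`.** [cite: MochizukiEtTh2009, §2 p.36] -/
theorem inversion₂_ne_refl : inversion₂ p ≠ ContinuousMulEquiv.refl (ThetaSetting.model₂ p).PiTemp := by
  intro h
  have h1 := toZ_inversion₂ p (genA₂ p)
  have h2 : inversion₂ p (genA₂ p) = genA₂ p := by rw [h]; rfl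
  rw [h2, toZ_genA₂, ← ofAdd_neg] at h1
  have h3 : (1 : ℤ) = -1 := Multiplicative.ofAdd.injective h1
  omega

/-- `toTheta` of the finer model is a quotient map (it is `QuotientGroup.mk` with the quotient topology).
[cite: MochizukiEtTh2009, §1 p.12] -/
theorem isQuotientMap_toTheta_model₂ : IsQuotientMap (ThetaSetting.model₂ p).toTheta :=
  QuotientGroup.isQuotientMap_mk (KTheta₂ p)

/-! ## §3. (R1e′) at the finer model, transferred from the discrete model through the common `Π_X` -/

/-- **The extended automorphisms coincide**: `ι̂₂ = ι̂₁` on the common profinite completion `Π_X = F̂₂ × Ĝ_{ℚ_p}` of the finer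
and of the discrete model — both are continuous and equal `(η ∘ σ) × η_Γ` on the image of the DISCRETE model's `Π^tp_X = F₂ × Γ`,
which is dense. [cite: MochizukiSemiAnbd2006, §6 p.69] -/
theorem completionAut_inversion₂_eq (z : PiHt p) :
    (ThetaSetting.model₂ p).completionAut (inversion₂ p) z = (ThetaSetting.model p).completionAut (inversion p) z := by
  let Φ : PiHt p →ₜ* PiHt p :=
    { toMonoidHom := ((ThetaSetting.model₂ p).completionAut (inversion₂ p)).toMulEquiv.toMonoidHom
      continuous_toFun := ((ThetaSetting.model₂ p).completionAut (inversion₂ p)).continuous }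
  let Ψ : PiHt p →ₜ* PiHt p :=
    { toMonoidHom := ((ThetaSetting.model p).completionAut (inversion p)).toMulEquiv.toMonoidHom
      continuous_toFun := ((ThetaSetting.model p).completionAut (inversion p)).continuous }
  have hΦΨ : Φ = Ψ := by
    refine IsProfiniteCompletion.extension_unique (ThetaSetting.model p).isProfiniteCompletion_toHat Φ Ψ fun x => ?_
    -- `x = (d, τ) ∈ F₂ × Γ`; its image in `Π_X` is also the image of the graph element `((η d, expA d), τ)` of the finer model
    let γ : Gfp := ⟨(eta (Del.val x.1), expA (Del.val x.1)), eta_mk_mem_Gfp _⟩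
    have hx : (ThetaSetting.model p).toHat x = (ThetaSetting.model₂ p).toHat ((γ, x.2) : PiTp₂ p) := rfl
    change (ThetaSetting.model₂ p).completionAut (inversion₂ p) ((ThetaSetting.model p).toHat x) =
      (ThetaSetting.model p).completionAut (inversion p) ((ThetaSetting.model p).toHat x)
    rw [TemperedCurve.completionAut_toHat, hx, TemperedCurve.completionAut_toHat]
    change toHat₂ p (inversion₂ p (γ, x.2)) = toHatM p (inversion p x)
    rw [toHat₂_apply, toHatM_apply, inversion₂_apply, inversion_apply, Del.val_inv, coe_gfpInv]
    change (sigmaHat (eta (Del.val x.1)), etaGam p x.2) = (eta (invGenHom (Del.val x.1)), etaGam p x.2)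
    rw [sigmaHat_eta]
  exact DFunLike.congr_fun (congrArg ContinuousMonoidHom.toMonoidHom hΦΨ) z

/-- The two models have the same `Δ_X = F̂₂ × 1 ⊆ Π_X`. [cite: MochizukiEtTh2009, §1 p.12] -/
theorem deltaHat_model₂_eq_model : (ThetaSetting.model₂ p).DeltaHat = (ThetaSetting.model p).DeltaHat :=
  (deltaHat₂_eq p).trans (deltaHat_eq p).symm

/-- **(R1e′) «`ι̂` acts as `−1` on `Δ_X^ab`» HOLDS at the finer model** — transferred from p424489's `inversion_hinv` through
`completionAut_inversion₂_eq` and `deltaHat_model₂_eq_model`. [cite: MochizukiEtTh2009, Prop 2.2 (i) p.37] -/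
theorem inversion₂_hinv : ∀ g ∈ (ThetaSetting.model₂ p).DeltaHat,
    (ThetaSetting.model₂ p).completionAut (inversion₂ p) g * g ∈
      (⁅(ThetaSetting.model₂ p).DeltaHat, (ThetaSetting.model₂ p).DeltaHat⁆).topologicalClosure := by
  intro g hg
  rw [completionAut_inversion₂_eq, deltaHat_model₂_eq_model]
  rw [deltaHat_model₂_eq_model] at hg
  exact inversion_hinv p g hg

/-! ## §4. Joint satisfiability with the origin guard AND the closedness clause `hYcl` -/

/-- **The (R1) inversion datum is consistent with the [EtTh] §1 root interface, its origin guard and the closedness clause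
`hYcl` (GAP G-w4d021-2).** There is a theta setting `D` with `D.IsEtThOrigin`, with `hYcl` («the image of `Δ^tp_Y` in
`Δ^Θ_X` is closed»), and a topological automorphism `ι` of `Π^tp_X` which is a nontrivial involution over `G_K`, satisfies (R1b′)
`ι(Δ^tp_X) = Δ^tp_X` and `IsQuotientMap toTheta`, reverses `Z`, and satisfies (R1e′) — witness the finer model `ThetaSetting.model₂ p`
with `SettingModel.inversion₂ p`. [cite: Mochizuki2012, Prop 2.2 (ii) p.66] -/
theorem _root_.Literature.AnabelianGeometry.EtaleTheta.ThetaSetting.exists_isEtThOrigin_hYcl_inversion :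
    ∃ (D : ThetaSetting p) (ι : D.PiTemp ≃ₜ* D.PiTemp), D.IsEtThOrigin ∧
      (D.DtpY.map D.toHat.toMonoidHom).topologicalClosure ≤
        D.DtpY.map D.toHat.toMonoidHom ⊔ (⁅⁅D.DeltaHat, D.DeltaHat⁆, D.DeltaHat⁆).topologicalClosure ∧
      ι ≠ ContinuousMulEquiv.refl D.PiTemp ∧ (∀ g, ι (ι g) = g) ∧ (∀ g, D.aug (ι g) = D.aug g) ∧
      D.DeltaTemp.map ι.toMulEquiv.toMonoidHom = D.DeltaTemp ∧ IsQuotientMap D.toTheta ∧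
      (∀ g, D.toZ (ι g) = (D.toZ g)⁻¹) ∧
      ∀ g ∈ D.DeltaHat, D.completionAut ι g * g ∈ (⁅D.DeltaHat, D.DeltaHat⁆).topologicalClosure :=
  ⟨ThetaSetting.model₂ p, inversion₂ p, ThetaSetting.model₂_isEtThOrigin p, hYcl_model₂ p, inversion₂_ne_refl p,
    inversion₂_inversion₂ p, aug_inversion₂ p, map_deltaTemp_inversion₂ p, isQuotientMap_toTheta_model₂ p,
    toZ_inversion₂ p, inversion₂_hinv p⟩

end Literature.AnabelianGeometry.EtaleTheta.SettingModel

end
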